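import Literature.NumberTheory.EllipticCurves.Kato2004.EulerSystemDefinedValues
import Summits.BirchSwinnertonDyer.BirchSwinnertonDyer.Theorems.KatoDescentPotSupersingularZetaBodyScaling
import Summits.BirchSwinnertonDyer.Rank1Residual.Additive.LocalLogImageRat
import HarnessLib

/-!
# Route `KimAtThreeKolyvagin` (W2): two TOOLS for the displayed position statement (item 21401 `KatoPeriodPositionThree`) —
# Kato's matrix rescales in its constant, and the duality-normalising scalar is rigid
# (cell `bsd-addord`, seat w2-c4 gen 14; `--supports stmt-BirchSwinnertonDyer-19077`, helper — closes nothing)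

HONEST FRAMING.  TOOL theorems only (no definition, no named fact, no instance, no `sorry`); any prime `p`, any globally
minimal `W/ℚ`; nothing here proves or refutes item 21401 / `KatoPeriodPositionAtThree` (the W2 route's own displayed hypothesis,
STRONGER than Kato's theorem, print status PRE).  BSD is NOT proved by any of this.

WHAT (the two ingredients of «POS= ⟺ POS≤ inside the ∃», w2-c4 gen 13 HANDOFF (iii) / w2-acc4 gen 7 (F2); the packaged
equivalence itself is stated over DEF-wrapped forms in `KimAtThreeShallowEqDeepPositionRescaleDefs` / `…PositionRescale`, because
a `theorem` whose STATEMENT spells the cross-application `Kato2004.DefinedExpStarBody W 3 f d …` at a `KatoPosition`-typed `d` inline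
exceeds the kernel heartbeat budget, while the same text as a `def : Prop` elaborates in seconds — seat finding 2026-08-27, NOTES):
* §1 `definedExpStarBody_natCast_mul` — the Literature MATRIX `Kato2004.DefinedExpStarBody W p f d ι κK Λ` (body of the fact
  `exists_eulerSystem_definedExpStar_values`) is closed under `κK ↦ n·κK` (`n : ℕ`) with `(d, ι, Λ)` FIXED: its (RES)/(DEF) block
  does not mention `κK`, and Kato's witness family rescales as `(z, x) ↦ (n • z, n·x)` (bsd-potss-kmc's `ZetaBodyScaling.zetaBody_smul`;
  w2-acc5 gen 8 recorded the family-level version `KimAtThreeFineKatoPositionNoFreeLunch.zetaFamily_smul`).  Consequence (paper, and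
  kernel in `…PositionRescale`): inside the `∃ (d ι κK Λ)` of item 21401 the displayed EQUALITY `v_3(u) = v(ι_3 e)` can always be
  reached from the INEQUALITY `v_3(u) ≤ v(ι_3 e)` by rescaling the datum by `3^{v(ι_3 e) − v_3(u)}` — the «=» asks nothing beyond the
  normalisation inequality `e(Ω⁺_f) ≥ 0` of crux 19077's docstring.
* §2 `forall_norm_mul_padicLog_le_one_iff` — the DUALITY BALL `{a : ∀ Q ∈ W(ℚ_p), ‖a · log_ω Q‖ ≤ 1}` IS the ball of radius
  `‖p^{−m}‖`, `log_ω(W(ℚ_p)) = p^m ℤ_p` (n1011's `range_padicLog_baseChange`, `m = 1 + t − v_p c_p − v_p #Ẽ_ns(𝔽_p)`);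
  `norm_eq_of_forall_mul_mem_iff_ball` / `valuation_eq_of_forall_mul_mem_iff_ball` — RIGIDITY: two nonzero scalars `E, E'` that both
  carry a set `R ⊆ ℚ_p` onto the duality ball (`E·a ∈ R ↔ ball(a)`, same for `E'`) have the same norm / valuation; in the W2 route
  `R` = range of `ι_p ∘ exp*_d` on cocycles and `E = ι_p e` for a duality-normalising scalar `e` of the line `d` (`KatoPosition`):
  ALL normalising scalars of a given `d` have the same valuation, so the `∀ e` in `KatoPosition` pins ONE integer.
References: [Kato2004Asterisque] (8.1.3), Prop. 8.12, §9.4, Thm. 9.7, Thm. 6.6 (1), Ex. 13.3; [BlochKato1990] §3 (Def. 3.10,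
Prop. 3.8, Ex. 3.11); [Kim2022StructureSelmer] §3.2.3; [SilvermanAEC2009] IV.6.4, VII.6.3.
-/

set_option autoImplicit false

noncomputable section

-- the cell's Theorems namespace `Summit.BirchSwinnertonDyer.BirchSwinnertonDyer.…` repeats the summit name by design (D-0017)
set_option linter.dupNamespace false

open scoped Classical NumberField TensorProduct
open Field IsDedekindDomain NumberField CongruenceSubgroup WeierstrassCurve
open Literature.NumberTheory.EllipticCurves
open Literature.NumberTheory.GaloisRepresentations
open Literature.NumberTheory.EllipticCurves.ModularForms
open Literature.NumberTheory.EllipticCurves.Kato2004 Literature.NumberTheory.EllipticCurves.Kato2004.EulerSystemValues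
open Summit.BirchSwinnertonDyer.Rank1Residual.Additive.LocalLog
open Rat.HeightOneSpectrum
open Summit.BirchSwinnertonDyer.BirchSwinnertonDyer.Theorems.ZetaBodyScaling

namespace Summit.BirchSwinnertonDyer.BirchSwinnertonDyer.Theorems.KimAtThreeShallowEqDeepPositionScaling

-- (no local instance attribute is needed here: the type of the matrix's line `d` is INFERRED from `Kato2004.DefinedExpStarBody`)

/-! ### §1 Kato's matrix is closed under `κK ↦ n·κK` -/

set_option backward.isDefEq.respectTransparency false in
/-- **Kato's matrix rescales in the constant.**  If `(d, ι, κK, Λ)` satisfies `Kato2004.DefinedExpStarBody W p f d ι κK Λ` then so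
does `(d, ι, n·κK, Λ)` for every `n : ℕ`: the (RES)/(DEF) block of the matrix does not involve `κK`, and for every admissible
`(c, d, a, A)` Kato's witnesses `(z, x)` are replaced by `(n • z, n·x)` (`ZetaBodyScaling.zetaBody_smul`: (C1)/(C2) are
`ℤ_p`-linear in `z`, (C4) is `Λ`-linear, (C5) is linear in `x` and `κK`).  TOOL; nothing asserted about Kato's elements.
[cite: Kato2004Asterisque, (8.1.3) (p. 180), Thm. 9.7 (p. 189), Thm. 6.6 (1) (p. 163), Ex. 13.3 (pp. 224–225)] -/
theorem definedExpStarBody_natCast_mul (W : WeierstrassCurve ℚ) [W.IsElliptic] (p : ℕ) [Fact p.Prime]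
    [ContinuousSMul ℤ_[p] (W.tateModule p)] [Module.Free ℤ_[p] (W.tateModule p)]
    [Module.Finite ℤ_[p] (W.tateModule p)]
    {N : ℕ} [NeZero N] (f : CuspForm (Gamma0 N) 2) {d : _}
    (ι : (n : ℕ) → (CyclotomicField n ℚ →+* ℂ)) (κK : ℝ)
    (Λ : ∀ (k' : ℕ) (r : Finset (HeightOneSpectrum (𝓞 ℚ))),
      H1 (tateRep W p) (cycSubgroup p k' r) →ₗ[ℤ_[p]] ℚ_[p] ⊗[ℚ] CyclotomicField (cycLevel p k' r) ℚ)
    (n : ℕ) (h : Kato2004.DefinedExpStarBody W p f d ι κK Λ) :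
    Kato2004.DefinedExpStarBody W p f d ι ((n : ℝ) * κK) Λ := by
  obtain ⟨hdef, hz⟩ := h
  refine ⟨hdef, fun c d' a A hA hc hd => ?_⟩
  obtain ⟨z, x, hzx⟩ := hz c d' a A hA hc hd
  exact ⟨(n : ℤ_[p]) • z, fun k r ↦ (n : CyclotomicField (cycLevel p k r.1) ℚ) * x k r, zetaBody_smul n hzx⟩

/-! ### §2 The duality ball and the rigidity of the duality-normalising scalar -/

/-- **The duality ball is an honest ball.**  For a globally minimal `W/ℚ` and any prime `p`:
`(∀ Q ∈ W(ℚ_p), ‖a · log_ω Q‖ ≤ 1) ↔ ‖a‖ ≤ ‖p^{−m}‖`, where `log_ω(W(ℚ_p)) = p^m ℤ_p` is n1011's `range_padicLog_baseChange`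
(`m = 1 + t − v_p c_p − v_p #Ẽ_ns(𝔽_p)`).  TOOL.
[cite: SilvermanAEC2009, IV.6.4 and VII.6.3] [cite: Kim2022StructureSelmer, §3.2.3 (PDF p. 16)] -/
theorem forall_norm_mul_padicLog_le_one_iff (W : WeierstrassCurve ℚ) [W.IsElliptic] [W.IsGloballyMinimal]
    (p : ℕ) [Fact p.Prime] (a : ℚ_[p]) :
    (∀ Q : (W.baseChange ℚ_[p]).toAffine.Point, ‖a * padicLog (W.baseChange ℚ_[p]) Q‖ ≤ 1) ↔
      ‖a‖ ≤ ‖(p : ℚ_[p]) ^ (-((1 : ℤ) + padicValNat p (Nat.card (AddCommGroup.torsion (W.baseChange ℚ_[p]).toAffine.Point)) -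
        padicValNat p ((W.baseChange ℚ_[p]).localTamagawaNumber ℤ_[p]) - padicValNat p (reductionPointCount W p)))‖ := by
  set m : ℤ := (1 : ℤ) + padicValNat p (Nat.card (AddCommGroup.torsion (W.baseChange ℚ_[p]).toAffine.Point)) -
    padicValNat p ((W.baseChange ℚ_[p]).localTamagawaNumber ℤ_[p]) - padicValNat p (reductionPointCount W p) with hm
  have hp0 : (p : ℚ_[p]) ≠ 0 := Nat.cast_ne_zero.mpr (Fact.out : p.Prime).ne_zero
  have hpm : (p : ℚ_[p]) ^ m ≠ 0 := zpow_ne_zero m hp0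
  have hrange := range_padicLog_baseChange W p
  rw [← hm] at hrange
  constructor
  · intro h
    -- a point with `log Q₀ = p^m`
    have hmem : (p : ℚ_[p]) ^ m ∈ (padicLog (W.baseChange ℚ_[p])).range := by
      rw [hrange, Submodule.mem_toAddSubgroup]
      exact Submodule.mem_span_singleton_self _
    obtain ⟨Q₀, hQ₀⟩ := hmem
    have h1 := h Q₀
    rw [hQ₀, norm_mul] at h1
    rw [zpow_neg, norm_inv, inv_eq_one_div, le_div_iff₀ (norm_pos_iff.mpr hpm)]
    exact h1
  · intro h Q
    have hQ : padicLog (W.baseChange ℚ_[p]) Q ∈ (padicLog (W.baseChange ℚ_[p])).range := ⟨Q, rfl⟩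
    rw [hrange, Submodule.mem_toAddSubgroup, Submodule.mem_span_singleton] at hQ
    obtain ⟨c, hc⟩ := hQ
    rw [← hc, Algebra.smul_def, PadicInt.algebraMap_apply, norm_mul, norm_mul]
    calc ‖a‖ * (‖(c : ℚ_[p])‖ * ‖(p : ℚ_[p]) ^ m‖)
        ≤ ‖(p : ℚ_[p]) ^ (-m)‖ * (1 * ‖(p : ℚ_[p]) ^ m‖) := by
          gcongr
          exact PadicInt.norm_le_one c
      _ = 1 := by
          rw [one_mul, ← norm_mul, ← zpow_add₀ hp0, neg_add_cancel, zpow_zero, norm_one]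

/-- **Rigidity of the duality scalar (norms).**  For a globally minimal `W/ℚ`, a prime `p`, a set `R ⊆ ℚ_p` and two NONZERO
scalars `E, E'`: if both `E` and `E'` carry `R` onto the duality ball — `E·a ∈ R ↔ (∀ Q, ‖a · log_ω Q‖ ≤ 1)` for all `a`, and
the same for `E'` — then `‖E‖ = ‖E'‖`.  (The ball is invariant under `a ↦ (E/E')·a` and `a ↦ (E'/E)·a`; being the honest
ball of radius `‖p^{−m}‖ > 0`, this forces `‖E/E'‖ = 1`.)  In the W2 route `R` is the range of `ι_p ∘ exp*_d` on cocycles and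
`E = ι_p e` for a duality-normalising scalar `e` of the line `d` (`KatoPosition`): ALL such scalars have the same size.  TOOL.
[cite: BlochKato1990, Def. 3.10 and Prop. 3.8] [cite: SilvermanAEC2009, IV.6.4 and VII.6.3] -/
theorem norm_eq_of_forall_mul_mem_iff_ball (W : WeierstrassCurve ℚ) [W.IsElliptic] [W.IsGloballyMinimal]
    (p : ℕ) [Fact p.Prime] (R : Set ℚ_[p]) {E E' : ℚ_[p]} (hE : E ≠ 0) (hE' : E' ≠ 0)
    (h : ∀ a : ℚ_[p], E * a ∈ R ↔
      ∀ Q : (W.baseChange ℚ_[p]).toAffine.Point, ‖a * padicLog (W.baseChange ℚ_[p]) Q‖ ≤ 1)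
    (h' : ∀ a : ℚ_[p], E' * a ∈ R ↔
      ∀ Q : (W.baseChange ℚ_[p]).toAffine.Point, ‖a * padicLog (W.baseChange ℚ_[p]) Q‖ ≤ 1) :
    ‖E‖ = ‖E'‖ := by
  have hp0 : (p : ℚ_[p]) ≠ 0 := Nat.cast_ne_zero.mpr (Fact.out : p.Prime).ne_zero
  -- the radius of the ball
  set ρ : ℚ_[p] := (p : ℚ_[p]) ^ (-((1 : ℤ) + padicValNat p (Nat.card (AddCommGroup.torsion (W.baseChange ℚ_[p]).toAffine.Point)) -
    padicValNat p ((W.baseChange ℚ_[p]).localTamagawaNumber ℤ_[p]) - padicValNat p (reductionPointCount W p))) with hρ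
  have hρ0 : ρ ≠ 0 := zpow_ne_zero _ hp0
  have hball : ∀ a : ℚ_[p], (∀ Q : (W.baseChange ℚ_[p]).toAffine.Point, ‖a * padicLog (W.baseChange ℚ_[p]) Q‖ ≤ 1) ↔
      ‖a‖ ≤ ‖ρ‖ := fun a => forall_norm_mul_padicLog_le_one_iff W p a
  -- the ball is invariant under `a ↦ (E/E')·a` and `a ↦ (E'/E)·a`
  have hinv : ∀ a : ℚ_[p], ‖a‖ ≤ ‖ρ‖ → ‖E / E' * a‖ ≤ ‖ρ‖ := by
    intro a ha
    have hR : E * a ∈ R := (h a).mpr ((hball a).mpr ha)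
    have hR' : E' * (E / E' * a) ∈ R := by
      rwa [← mul_assoc, mul_div_cancel₀ _ hE']
    exact (hball _).mp ((h' _).mp hR')
  have hinv' : ∀ a : ℚ_[p], ‖a‖ ≤ ‖ρ‖ → ‖E' / E * a‖ ≤ ‖ρ‖ := by
    intro a ha
    have hR : E' * a ∈ R := (h' a).mpr ((hball a).mpr ha)
    have hR' : E * (E' / E * a) ∈ R := by
      rwa [← mul_assoc, mul_div_cancel₀ _ hE]
    exact (hball _).mp ((h _).mp hR')
  have hρpos : 0 < ‖ρ‖ := norm_pos_iff.mpr hρ0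
  have h1 : ‖E / E'‖ ≤ 1 := by
    have := hinv ρ le_rfl
    rw [norm_mul] at this
    exact (mul_le_iff_le_one_left hρpos).mp this
  have h2 : ‖E' / E‖ ≤ 1 := by
    have := hinv' ρ le_rfl
    rw [norm_mul] at this
    exact (mul_le_iff_le_one_left hρpos).mp this
  rw [norm_div, div_le_one (norm_pos_iff.mpr hE')] at h1
  rw [norm_div, div_le_one (norm_pos_iff.mpr hE)] at h2
  exact le_antisymm h1 h2

/-- **Rigidity of the duality scalar (valuations).**  Under the hypotheses of `norm_eq_of_forall_mul_mem_iff_ball` the two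
scalars have the same `p`-adic valuation.  TOOL.
[cite: BlochKato1990, Def. 3.10 and Prop. 3.8] [cite: SilvermanAEC2009, IV.6.4 and VII.6.3] -/
theorem valuation_eq_of_forall_mul_mem_iff_ball (W : WeierstrassCurve ℚ) [W.IsElliptic] [W.IsGloballyMinimal]
    (p : ℕ) [Fact p.Prime] (R : Set ℚ_[p]) {E E' : ℚ_[p]} (hE : E ≠ 0) (hE' : E' ≠ 0)
    (h : ∀ a : ℚ_[p], E * a ∈ R ↔
      ∀ Q : (W.baseChange ℚ_[p]).toAffine.Point, ‖a * padicLog (W.baseChange ℚ_[p]) Q‖ ≤ 1)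
    (h' : ∀ a : ℚ_[p], E' * a ∈ R ↔
      ∀ Q : (W.baseChange ℚ_[p]).toAffine.Point, ‖a * padicLog (W.baseChange ℚ_[p]) Q‖ ≤ 1) :
    E.valuation = E'.valuation := by
  have hn := norm_eq_of_forall_mul_mem_iff_ball W p R hE hE' h h'
  rw [Padic.norm_eq_zpow_neg_valuation hE, Padic.norm_eq_zpow_neg_valuation hE'] at hn
  have hp1 : (1 : ℝ) < p := by exact_mod_cast (Fact.out : p.Prime).one_lt
  exact neg_injective (zpow_right_injective₀ (by linarith) hp1.ne' hn)


/-- **Rigidity, function form** (the shape of `KatoPosition`'s premise): if `c : C → ℚ_p` is any map (in the W2 route: `ι_p ∘ exp*_d`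
on cocycles) and two nonzero scalars `E, E'` both satisfy «`(∃ η, c η = E·a) ↔ ball(a)` for all `a`», then `E` and `E'` have the same
`p`-adic valuation.  TOOL.
[cite: BlochKato1990, Def. 3.10 and Prop. 3.8] [cite: SilvermanAEC2009, IV.6.4 and VII.6.3] -/
theorem valuation_eq_of_forall_exists_eq_mul_iff_ball (W : WeierstrassCurve ℚ) [W.IsElliptic] [W.IsGloballyMinimal]
    (p : ℕ) [Fact p.Prime] {C : Type*} (c : C → ℚ_[p]) {E E' : ℚ_[p]} (hE : E ≠ 0) (hE' : E' ≠ 0)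
    (h : ∀ a : ℚ_[p], (∃ η : C, c η = E * a) ↔
      ∀ Q : (W.baseChange ℚ_[p]).toAffine.Point, ‖a * padicLog (W.baseChange ℚ_[p]) Q‖ ≤ 1)
    (h' : ∀ a : ℚ_[p], (∃ η : C, c η = E' * a) ↔
      ∀ Q : (W.baseChange ℚ_[p]).toAffine.Point, ‖a * padicLog (W.baseChange ℚ_[p]) Q‖ ≤ 1) :
    E.valuation = E'.valuation :=
  valuation_eq_of_forall_mul_mem_iff_ball W p (Set.range c) hE hE'
    (fun a => by rw [Set.mem_range]; exact h a) (fun a => by rw [Set.mem_range]; exact h' a)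

end Summit.BirchSwinnertonDyer.BirchSwinnertonDyer.Theorems.KimAtThreeShallowEqDeepPositionScaling

end
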